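import Literature.AnabelianGeometry.AbsoluteAnabelian.AbsTopII.TwoTripodNodalIndexBranchPair
import Literature.AnabelianGeometry.AbsoluteAnabelian.AbsTopII.TwoTripodNodalIndexProp13x
import Literature.AnabelianGeometry.AbsoluteAnabelian.AbsTopII.TwoTripodNodalOpenness
import HarnessLib

/-!
# [AbsTopII] Prop 1.3 at the index-`i` two-vertex datum, V: the typed column (iv′), (v), (vi), (vii), (viii′), (ix)

S. Mochizuki, *Topics in Absolute Anabelian Geometry II* [AbsTopII] (bib `MochizukiAbsTopII2013`; locators =
PDF pages of the kurims manuscript `paper:url-585b8d0ad0d9`), §1 Prop 1.3 (iv)–(ix) pp. 11–12: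

> "(v) `D_v = C_{Π_H}(I_v) = N_{Π_H}(I_v)` is commensurably terminal in `Π_H` […] (vii) Let `e` be an edge of `𝔾`.
> Then `D_e = C_{Π_H}(Π_e) = N_{Π_H}(Π_e)` is commensurably terminal in `Π_H`. If `e` is a node, then `I_e = D_e ∩ Π_I`.
> (viii) […] in the situation of (2), we have `I_v = D_e ∩ D_{e'} ∩ Π_I`."

PROOF-ONLY companion (abc-iut-f-066 gen 8, row «TWO-VERTEX-Σ-INDEX-i») of `AbsTopII/TwoTripodNodalIndexDatum.lean`.
The index-`i` datum `M.dpscIdx` has the SAME decomposition groups as the regular smoothing `M.dpsc` (normalisers in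
`Π_H = P`) and inertia groups cut down to `Π_I^{(i)}`; accordingly the typed D-group rows transfer from abc-iut-f-066
gen 5/6 (`TwoTripodNodalOpenness`, `…Prop13v`, `…Prop13viiiHolds`) with the `Π_I`-clauses re-read at `Π_I^{(i)}`:

* `prop13vi_dpscIdx`, `prop13ix_dpscIdx` (F-0279, F-0277) — verbatim (D-groups and `Π_𝔾` only);
* `prop13vii_dpscIdx` (F-0280) — with «`I_e = D_e ∩ Π_I`» now `Π_e·closure ⟨t₀^i⟩ = (Π_e·T) ∩ Π_I^{(i)}`;
* `prop13iv'_dpscIdx` — trichotomy at two adjacent vertices; «In particular» `I_{v_A} ∩ γ I_{v_B} γ⁻¹ = 1` for every `γ`;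
* `prop13v_dpscIdx` (F-0278) — `D_v = C_{Π_H}(I_v) = N_{Π_H}(I_v)` for the NEW `I_v = closure ⟨s^i⟩`: `C(closure ⟨s^i⟩) =
  C(closure ⟨s⟩)` (COMMENSURABLE subgroups, index `i`; Mathlib `Subgroup.Commensurable.eq`) and
  `N(closure ⟨s^i⟩) = D_v` (`D_v` centralises `I_v(dpsc)`, gen 6);
* `prop_1_3_viii'_dpscIdx` — the typed (viii′) with «Moreover» `h I_v h⁻¹ = D_e ∩ γD_{e'}γ⁻¹ ∩ Π_I^{(i)}` obtained from
  gen 6's (viii′) at `dpsc` by intersecting with the normal `Π_I^{(i)}`;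
* ★★★ `prop_1_3_typed_column_dpscIdx` — **ONE statement, NO hypothesis: at the index-`i` two-vertex datum the typed
  (i) (ii′) (iii) (iii′) (iv′) (v) (vi) (vii) (viii′) (ix) (x″) HOLD and the free-label (x), (x′) FAIL — every `Σ`,
  every `Σ`-integer `i`** (with gen 7's column at `dpsc` and abc-iut-f-069's at the loop datum, every nodal DPSC datum
  of the tree decides the typed Prop 1.3 column).
HONEST FRAMING: classical profinite group theory at a constructed model (constructed ≠ geometric); consistency evidence
for the typed rows, not a discharge at geometric data; nothing here bears on [IUTchIII] Cor 3.12; no side taken; typed ≠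
proved for print's statement about all stable log curves.
-/

noncomputable section

open scoped Pointwise

namespace Literature.AnabelianGeometry.AbsoluteAnabelian.AbsTopII.TwoTripodNodal.Model

open Literature.AnabelianGeometry.SemiGraphs
open Literature.AnabelianGeometry.SemiGraphs.SemiGraphOfAnabelioids (IsProSigmaCompletion)
open Literature.AnabelianGeometry.SemiGraphs.SemiGraphOfAnabelioids.IsProSigmaCompletion
open Literature.AnabelianGeometry.Anabelioids (IsSigmaInteger normalizer_le_commensurator)
open Literature.GroupTheory.CombinatorialGroupTheory
open Literature.GroupTheory.CombinatorialGroupTheory.PuncturedSurfaceGroup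
open _root_.Topology

variable {Sigma : Set ℕ} (M : Model Sigma) (i : ℕ)
variable (hne : Sigma.Nonempty) (hprime : ∀ p ∈ Sigma, p.Prime) (hi : IsSigmaInteger Sigma i)

/-! ### (vi), (ix): decomposition groups and `Π_𝔾` only — verbatim from `dpsc` -/

/-- **[AbsTopII] Prop 1.3 (vi) (`DPSCData.Prop13vi`, F-0279) HOLDS at the index-`i` two-vertex datum, NO hypothesis**
(same `D_v`, same `Π_𝔾` as `dpsc`; abc-iut-f-066 gen 5). [cite: MochizukiAbsTopII2013, Prop 1.3 (vi) p.12] -/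
theorem prop13vi_dpscIdx :
    Literature.AnabelianGeometry.AbsoluteAnabelian.DPSCData.Prop13vi (M.dpscIdx hne hprime i hi).toDPSCData :=
  M.prop13vi_dpsc hne hprime

/-- **[AbsTopII] Prop 1.3 (ix) (`DPSCData.Prop13ix`, F-0277) HOLDS at the index-`i` two-vertex datum, NO hypothesis**
(same `D_e`, `D_c`, `Π_𝔾` as `dpsc`; abc-iut-f-066 gen 5). [cite: MochizukiAbsTopII2013, Prop 1.3 (ix) p.12] -/
theorem prop13ix_dpscIdx :
    Literature.AnabelianGeometry.AbsoluteAnabelian.DPSCData.Prop13ix (M.dpscIdx hne hprime i hi).toDPSCData :=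
  M.prop13ix_dpsc hne hprime

/-! ### (vii): `I_e = D_e ∩ Π_I` re-read at `Π_I^{(i)}` -/

/-- **[AbsTopII] Prop 1.3 (vii) (`DPSCData.Prop13vii`, F-0280) HOLDS at the index-`i` two-vertex datum, NO hypothesis**:
`D_e = C(Π_e)` commensurably terminal for the node and the four cusps (as at `dpsc`), and «`I_e = D_e ∩ Π_I`» reads
`Π_e · closure ⟨t₀^i⟩ = (Π_e · T) ∩ Π_I^{(i)}`. [cite: MochizukiAbsTopII2013, Prop 1.3 (vii) p.12] -/
theorem prop13vii_dpscIdx :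
    Literature.AnabelianGeometry.AbsoluteAnabelian.DPSCData.Prop13vii (M.dpscIdx hne hprime i hi).toDPSCData := by
  refine ⟨fun e => ⟨(M.prop13vii_node_dpsc hne hprime e).1, (M.prop13vii_node_dpsc hne hprime e).2.1, ?_⟩,
    fun e => M.prop13vii_cusp_dpsc hne hprime e⟩
  rw [IvNode_dpscIdx_eq, DvNode_dpscIdx, DvNode_eq_WT, dpscIdx_PiI]
  exact (M.WT_inf_PiIdx i).symm

/-! ### (iv′): trichotomy at two adjacent vertices; `I_{v_A} ∩ γ I_{v_B} γ⁻¹ = 1` -/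

/-- `closure ⟨t₀^i⟩ ∩ γ · closure ⟨u₀^i⟩ · γ⁻¹ = 1` for every `γ ∈ P` (`T ∩ γUγ⁻¹ = 1`, abc-iut-f-066 gen 5).
[cite: MochizukiAbsTopII2013, Prop 1.3 (iv) p.11] -/
theorem Tpow_inf_conj_Upow (γ : M.P) : M.Tpow i ⊓ MulAut.conj γ • M.Upow i = ⊥ := by
  rw [eq_bot_iff, ← (M.T_inf_conj_U γ).1]
  exact inf_le_inf (M.Tpow_le_T i) (Subgroup.pointwise_smul_le_pointwise_smul_iff.mpr (M.Upow_le_U i))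

/-- `closure ⟨u₀^i⟩ ∩ γ · closure ⟨t₀^i⟩ · γ⁻¹ = 1` for every `γ ∈ P`. [cite: MochizukiAbsTopII2013, Prop 1.3 (iv) p.11] -/
theorem Upow_inf_conj_Tpow (γ : M.P) : M.Upow i ⊓ MulAut.conj γ • M.Tpow i = ⊥ := by
  rw [eq_bot_iff, ← (M.T_inf_conj_U γ).2]
  exact inf_le_inf (M.Upow_le_U i) (Subgroup.pointwise_smul_le_pointwise_smul_iff.mpr (M.Tpow_le_T i))

/-- **[AbsTopII] Prop 1.3 (iv), trichotomy + «In particular» (`Prop13iv'`) HOLDS at the index-`i` two-vertex datum, NO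
hypothesis**; the «In particular» clause `I_{v_A} ∩ γ I_{v_B} γ⁻¹ = {1}` holds for EVERY `γ ∈ P`.
[cite: MochizukiAbsTopII2013, Prop 1.3 (iv) p.11] -/
theorem prop13iv'_dpscIdx :
    Literature.AnabelianGeometry.AbsoluteAnabelian.DPSCData.Prop13iv' (M.dpscIdx hne hprime i hi).toDPSCData := by
  refine ⟨fun v v' γ _ _ => ?_, fun v v' γ _ h => ?_⟩
  · by_cases hvv : v = v'
    · exact Or.inl hvv
    · exact Or.inr (Or.inl ⟨hvv, M.adjacent_dpsc hne hprime v v'⟩)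
  · by_contra hvv
    apply h
    rcases M.vert_cases_dpscIdx i hne hprime hi v with rfl | rfl <;>
      rcases M.vert_cases_dpscIdx i hne hprime hi v' with rfl | rfl
    · exact absurd rfl hvv
    · rw [Iv_zero_dpscIdx, Iv_one_dpscIdx]; exact M.Tpow_inf_conj_Upow i γ
    · rw [Iv_zero_dpscIdx, Iv_one_dpscIdx]; exact M.Upow_inf_conj_Tpow i γ
    · exact absurd rfl hvv

/-! ### (v): `D_v = C(I_v) = N(I_v)` for the index-`i` inertia sections -/

/-- **`I_v(dpscIdx)` and `I_v(dpsc)` are COMMENSURABLE**: `closure ⟨s^i⟩ ⊆ closure ⟨s⟩` has index `i` (`s = t₀, u₀`).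
[cite: MochizukiAbsTopII2013, Prop 1.3 (v) p.12] -/
theorem commensurable_Iv_dpscIdx (v : (M.dpscIdx hne hprime i hi).Vert) :
    Subgroup.Commensurable ((M.dpscIdx hne hprime i hi).Iv v) ((M.dpsc hne hprime).Iv v) := by
  have hT : (M.Tpow i).relIndex M.T ≠ 0 := by
    rw [Subgroup.relIndex, Tpow_subgroupOf_T, (M.isOpen_TpowT i hi).2]; exact hi.1.ne'
  have hU : (M.Upow i).relIndex M.U ≠ 0 := by
    rw [Subgroup.relIndex, Upow_subgroupOf_U, (M.isOpen_UpowU i hne hprime hi).2]; exact hi.1.ne'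
  constructor
  · -- `[I_v(dpsc) : I_v(dpscIdx)] = i ≠ 0`
    rcases M.vert_cases_dpscIdx i hne hprime hi v with rfl | rfl
    · rw [Iv_zero_dpscIdx, M.Iv_eq_T hne hprime]; exact hT
    · rw [Iv_one_dpscIdx, M.Iv_eq_U hne hprime]; exact hU
  · -- `[I_v(dpscIdx) : I_v(dpsc)] = 1`
    rw [Subgroup.relIndex_eq_one.mpr (M.Iv_dpscIdx_le i hne hprime hi v)]; exact one_ne_zero

/-- **[AbsTopII] Prop 1.3 (v) (`DPSCData.Prop13v`, F-0278) HOLDS at the index-`i` two-vertex datum, NO hypothesis**: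
`D_v = C_{Π_H}(I_v)` (commensurators of commensurable subgroups agree; gen 6 at `dpsc`), `D_v = N_{Π_H}(I_v)` (`D_v`
centralises `I_v(dpsc) ⊇ I_v`, and `N ⊆ C`), `D_v` commensurably terminal, `D_v ∩ Π_𝔾 = Π_v` commensurably terminal in
`Π_𝔾` (verbatim). [cite: MochizukiAbsTopII2013, Prop 1.3 (v) p.12] -/
theorem prop13v_dpscIdx :
    Literature.AnabelianGeometry.AbsoluteAnabelian.DPSCData.Prop13v (M.dpscIdx hne hprime i hi).toDPSCData := by
  intro v
  obtain ⟨h1, -, h3⟩ := M.Dv_eq_commensurator_Iv hne hprime v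
  have hcomm : Subgroup.Commensurable.commensurator ((M.dpscIdx hne hprime i hi).Iv v) =
      Subgroup.Commensurable.commensurator ((M.dpsc hne hprime).Iv v) := (M.commensurable_Iv_dpscIdx i hne hprime hi v).eq
  have hD1 : (M.dpscIdx hne hprime i hi).Dv v = Subgroup.Commensurable.commensurator ((M.dpscIdx hne hprime i hi).Iv v) := by
    rw [Dv_dpscIdx, h1]; exact hcomm.symm
  refine ⟨hD1, ?_, M.isCommensurablyTerminal_Dv hne hprime v, M.Dv_inf_PiG hne hprime v,
    M.isCommensurablyTerminal_vertSub hne hprime v⟩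
  apply le_antisymm
  · -- `D_v ⊆ Z(I_v(dpsc)) ⊆ Z(I_v) ⊆ N(I_v)`
    have hZ : (M.dpscIdx hne hprime i hi).Dv v ≤ Subgroup.centralizer (((M.dpscIdx hne hprime i hi).Iv v :
        Subgroup (M.dpscIdx hne hprime i hi).PiH) : Set (M.dpscIdx hne hprime i hi).PiH) := by
      rw [Dv_dpscIdx, h3]
      exact Subgroup.centralizer_le (M.Iv_dpscIdx_le i hne hprime hi v)
    exact hZ.trans (Subgroup.centralizer_le_normalizer _)
  · rw [hD1]; exact normalizer_le_commensurator _

/-! ### (viii′): intersect gen 6's «Moreover» with the normal `Π_I^{(i)}` -/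

/-- **[AbsTopII] Prop 1.3 (viii) AS TYPED (`Prop_1_3_viii'`) HOLDS at the index-`i` two-vertex datum, NO hypothesis**:
for edges `e ≠ e'` and `γ ∈ Π_𝔾` with `D_e ∩ γD_{e'}γ⁻¹ ∩ Π_I^{(i)} ≠ 1`, the common vertex, the `Π_𝔾`-clause and the
conjugating `h ∈ Π_𝔾` are those of abc-iut-f-066 gen 6 at `dpsc`, and `h I_v h⁻¹ = D_e ∩ γD_{e'}γ⁻¹ ∩ Π_I^{(i)}`
follows by intersecting `h I_v(dpsc) h⁻¹ = D_e ∩ γD_{e'}γ⁻¹` with the normal `Π_I^{(i)}`.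
[cite: MochizukiAbsTopII2013, Prop 1.3 (viii) p.12] -/
theorem prop_1_3_viii'_dpscIdx :
    Literature.AnabelianGeometry.AbsoluteAnabelian.AbsTopII.DPSCIndexData.Prop_1_3_viii' (M.dpscIdx hne hprime i hi) := by
  haveI := M.normal_PiIdx i
  have hn : ∀ g : M.P, MulAut.conj g • M.PiIdx i = M.PiIdx i := fun g => Subgroup.Normal.conj_smul_eq_self g (M.PiIdx i)
  -- the statement read at the edges of `dpsc` (same edges, same `D`-groups; `I_v = Z(Π_v) ∩ Π_I^{(i)}`)
  have main : ∀ (e e' : (M.dpsc hne hprime).Edge) (γ : (M.dpsc hne hprime).PiH), γ ∈ (M.dpsc hne hprime).PiG →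
      (M.dpsc hne hprime).DEdge e ⊓ MulAut.conj γ • (M.dpsc hne hprime).DEdge e' ⊓ M.PiIdx i ≠ ⊥ →
      e = e' ∨ (e ≠ e' ∧ ∃ v : (M.dpsc hne hprime).Vert, (M.dpsc hne hprime).EdgeAbuts e v ∧
        (M.dpsc hne hprime).EdgeAbuts e' v ∧
        (M.dpsc hne hprime).DEdge e ⊓ MulAut.conj γ • (M.dpsc hne hprime).DEdge e' ⊓ (M.dpsc hne hprime).PiG = ⊥ ∧
        ∃ h : (M.dpsc hne hprime).PiH, h ∈ (M.dpsc hne hprime).PiG ∧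
          MulAut.conj h • (Subgroup.centralizer (((M.dpsc hne hprime).vertSub v : Subgroup (M.dpsc hne hprime).PiH) :
              Set (M.dpsc hne hprime).PiH) ⊓ M.PiIdx i) =
            (M.dpsc hne hprime).DEdge e ⊓ MulAut.conj γ • (M.dpsc hne hprime).DEdge e' ⊓ M.PiIdx i) := by
    intro e e' γ hγ hX
    have hX' : (M.dpsc hne hprime).DEdge e ⊓ MulAut.conj γ • (M.dpsc hne hprime).DEdge e' ⊓ (M.dpsc hne hprime).PiI ≠ ⊥ := by
      intro h
      apply hX
      rw [dpsc_PiI, inf_top_eq] at h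
      rw [h, bot_inf_eq]
    rcases M.prop_1_3_viii'_dpsc hne hprime e e' γ hγ hX' with h | ⟨hne', v, hev, he'v, hG, h0, hh0, hIv⟩
    · exact Or.inl h
    · refine Or.inr ⟨hne', v, hev, he'v, hG, h0, hh0, ?_⟩
      unfold DPSCData.Iv at hIv
      rw [dpsc_PiI, inf_top_eq, inf_top_eq] at hIv
      rw [Subgroup.smul_inf, hIv]
      exact congrArg _ (hn h0)
  intro e e' γ hγ hX
  rcases e with n | c <;> rcases e' with n' | c' <;> exact main _ _ γ hγ hX

/-! ### The typed column at the index-`i` datum -/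

/-- ★★★ **The typed [AbsTopII] Prop 1.3 column at the index-`i` two-vertex nodal datum, ONE statement, NO hypothesis**:
for every nonempty set of primes `Σ`, every model `M` and every `Σ`-integer `i`, at `M.dpscIdx` (degenerating 4-pointed
sphere, node index `i_e = i^Σ_e = i`, `Π_I = Π_𝔾·closure ⟨t₀^i⟩`) the typed (i), (ii′) [index clause `= i`], (iii),
(iii′), (iv′), (v), (vi), (vii), (viii′), (ix) and (x″) [for the log-point family with nodal members] HOLD, and the
free-label predicates (x), (x′) FAIL. [cite: MochizukiAbsTopII2013, Prop 1.3 pp.11–12] -/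
theorem prop_1_3_typed_column_dpscIdx :
    (M.dpscIdx hne hprime i hi).Prop_1_3_i ∧ (M.dpscIdx hne hprime i hi).Prop_1_3_ii' ∧
      (M.dpscIdx hne hprime i hi).toDPSCData.Prop13iii ∧ (M.dpscIdx hne hprime i hi).Prop_1_3_iii' ∧
      (M.dpscIdx hne hprime i hi).toDPSCData.Prop13iv' ∧ (M.dpscIdx hne hprime i hi).toDPSCData.Prop13v ∧
      (M.dpscIdx hne hprime i hi).toDPSCData.Prop13vi ∧ (M.dpscIdx hne hprime i hi).toDPSCData.Prop13vii ∧
      (M.dpscIdx hne hprime i hi).Prop_1_3_viii' ∧ (M.dpscIdx hne hprime i hi).toDPSCData.Prop13ix ∧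
      (M.dpscIdx hne hprime i hi).Prop_1_3_x'' (M.logPointsIdx i hne hprime hi) ∧
      ¬ (M.dpscIdx hne hprime i hi).Prop_1_3_x ∧ ¬ (M.dpscIdx hne hprime i hi).Prop_1_3_x' :=
  ⟨M.prop_1_3_i_dpscIdx i hne hprime hi, M.prop_1_3_ii'_dpscIdx i hne hprime hi, M.prop13iii_dpscIdx i hne hprime hi,
    M.prop_1_3_iii'_dpscIdx i hne hprime hi, M.prop13iv'_dpscIdx i hne hprime hi, M.prop13v_dpscIdx i hne hprime hi,
    M.prop13vi_dpscIdx i hne hprime hi, M.prop13vii_dpscIdx i hne hprime hi, M.prop_1_3_viii'_dpscIdx i hne hprime hi,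
    M.prop13ix_dpscIdx i hne hprime hi, M.prop_1_3_x''_dpscIdx i hne hprime hi, M.not_prop_1_3_x_dpscIdx i hne hprime hi,
    M.not_prop_1_3_x'_dpscIdx i hne hprime hi⟩

/-- **Census form: for every nonempty set of primes `Σ` and every `Σ`-integer `i`, a DPSC datum WITH TWO DISTINCT
ADJACENT VERTICES and node `Σ`-index `i` carrying the whole typed Prop 1.3 column.**
[cite: MochizukiAbsTopII2013, Prop 1.3 pp.11–12] -/
theorem exists_twoVertex_nodal_model_index_column (Sigma : Set ℕ) (hne : Sigma.Nonempty)
    (hprime : ∀ p ∈ Sigma, p.Prime) (i : ℕ) (hi : IsSigmaInteger Sigma i) :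
    ∃ (X : DPSCIndexData.{0}) (L : Type) (pt : L → X.LogPointData),
      X.Sigma = Sigma ∧ (∃ v v' : X.Vert, v ≠ v' ∧ X.Adjacent v v') ∧ (∀ e : X.Node, X.sigmaIndex e = i) ∧
      X.Prop_1_3_i ∧ X.Prop_1_3_ii' ∧ X.toDPSCData.Prop13iii ∧ X.Prop_1_3_iii' ∧ X.toDPSCData.Prop13iv' ∧
      X.toDPSCData.Prop13v ∧ X.toDPSCData.Prop13vi ∧ X.toDPSCData.Prop13vii ∧ X.Prop_1_3_viii' ∧
      X.toDPSCData.Prop13ix ∧ X.Prop_1_3_x'' pt ∧ ¬ X.Prop_1_3_x ∧ ¬ X.Prop_1_3_x' := by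
  obtain ⟨M⟩ := Model.nonempty Sigma
  exact ⟨M.dpscIdx hne hprime i hi, M.LogPtIdx i, M.logPointsIdx i hne hprime hi, rfl,
    ⟨⟨(0 : Fin 2)⟩, ⟨(1 : Fin 2)⟩, M.vert_zero_ne_one hne hprime, M.adjacent_dpsc hne hprime _ _⟩, fun _ => rfl,
    M.prop_1_3_typed_column_dpscIdx i hne hprime hi⟩

end Literature.AnabelianGeometry.AbsoluteAnabelian.AbsTopII.TwoTripodNodal.Model

end
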